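import Summits.QuantumFields.YangMills.Theorems.IR.AfPincerUcSharpOnset
import Literature.MathematicalPhysics.QuantumFieldTheory.WilsonTransferKernel
import HarnessLib

/-!
# Crux `IR` (item stmt-QuantumFields-19354, route-QuantumFields-BalabanLadder) — vocabulary of the line `vacuum_escape`
(«assume NO gap ⇒ a STICKY SLICE EVENT ⇒ isoperimetry forbids it»; ideator ym-ir-idea-8)

Helper module for item `stmt-QuantumFields-19354` (`--supports … --as helper`; it closes nothing).  Route-posited objects of the
REGISTERED skeleton `Cruxes/IR/Lines/vacuum_escape.lean` (v3, critics ym-ir-crit-1 ∕ ym-ir-crit-2: PASS-WITH-PRICE), made tree constants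
so that every registered stub (`stub_noStickySliceEvent`, `stub_cheeger`, `stub_coldPurity`, `stub_spectralSeam`, `stub_rungStrongCoupling`;
the residual `stub_irNSC : AfPincerUc.SharpOnset.IRNSC` is already a tree constant) can be closed by a `Theorems/` file proving a constant of
THIS module BY NAME, and so that the skeleton re-bases on `import …Theorems.IR.VacuumEscapeDefs`.  Statements VERBATIM the skeleton's
(§0 slice-chain probabilities `cyclicExpectation`, `sliceMass`, `sliceStay`, `sliceStayN`; §1 the currencies `SliceConductanceInUnits`,
`PhysicalTimeConductance`, `SliceGapInUnits`, `ColdPurity`, `SliceConductanceStrongCoupling`; `IRSC`); the stubs themselves are NOT here;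
NOTHING is asserted except the kernel-checked compositions `irCal_of_SC_NSC : IRSC → IRNSC → IRCal` and `ir_of_vacuumEscape` (the five stub
statements as HYPOTHESES `⇒` crux `IR` BY NAME; the skeleton's `IR_of` is this term applied to its stubs).

## The lever (one object)

The ESCAPE RATE of a set of spatial gauge fields under one step of Euclidean time.  Slice the torus `m × (2S+1)³`
across time (tree: `wilsonSliceKernel`, `cyclicPartition`, `traceExcess`, Osterwalder–Seiler 1978 §§2–3).  For a
measurable set `A` of time-zero slice configurations put `mass_m(A) = P(V₀ ∈ A)` and `stay_m(A) = P(V₀ ∈ A ∧ V₁ ∈ A)`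
under the slice-chain law of the torus (`sliceMass`, `sliceStay`; plain cyclic integrals of slice kernels with
indicator insertions).  As `m → ∞` these converge to the vacuum chain's `π(A)` and `Q(A, A)` (ground-state transform of
the transfer operator; Perron–Jentzsch), and the Lawler–Sokal form of CHEEGER'S INEQUALITY for Markov operators on general state
spaces, `1 − λ₁/λ₀ ≥ k²/8` (tree, PROVED: `Literature.Probability.MarkovChains.cheeger_variance_le_dirichletForm`), turns a
CONDUCTANCE LOWER BOUND into the gap face `SliceGapInUnits` (seam `stub_cheeger`, M).

HONEST FRAMING: vocabulary and bookkeeping for ONE open gap-crux of a CONDITIONAL chain; nothing here proves weak-coupling mixing or a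
mass gap; the Clay problem is untouched; `R4` of the ladder closes only the conditional finite-𝕋⁴ rung `BalabanLadder.UV`.

Refs: line card `Cruxes/IR/Lines/vacuum_escape.md`; crux idea `Cruxes/IR/Ideas/vacuum-escape.md`; G. F. Lawler, A. D. Sokal, Trans. AMS 309
(1988) 557, Thm 2.1; K. Osterwalder, E. Seiler, Ann. Phys. 110 (1978) 440, §§2–3; tree `Literature/MathematicalPhysics/QuantumFieldTheory/
WilsonTransferKernel.lean`, `WilsonTorusTransferMatrix.lean`.
-/

set_option autoImplicit false

noncomputable section

open Filter Topology MeasureTheory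
open Literature.MathematicalPhysics.QuantumFieldTheory
open Summit.QuantumFields.YangMills.Cruxes.OSLegsFromFemtoAndGap.DlrCollarTransfer (GapInUnits LowerBounds)
open Summit.QuantumFields.YangMills.Cruxes.IR.AfPincerUc (IRCal)
open Summit.QuantumFields.YangMills.Cruxes.IR.AfPincerUc.SharpOnset (IRNSC)

namespace Summit.QuantumFields.YangMills.Cruxes.IR.VacuumEscape

/-! ## §0 Vocabulary: slice-chain probabilities on the asymmetric torus `m × N³` -/

section SliceChain

variable {N n : ℕ} {G : Type*} [Group G] [TopologicalSpace G] [IsTopologicalGroup G] [CompactSpace G]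
  [MeasurableSpace G] [BorelSpace G] (ρ : G →* Matrix (Fin n) (Fin n) ℂ)

/-- Expectation of a functional `F` of the slice chain `V : ZMod m → GaugeConfig 3 N G` under the law of the
asymmetric torus `m × N³`: the cyclic integral of slice kernels (exactly as in `cyclicPartition`) with `F` inserted,
normalised by `cyclicPartition`. -/
def cyclicExpectation (β : ℝ) (N m : ℕ) [NeZero N] [NeZero m]
    (F : (ZMod m → GaugeConfig 3 N G) → ℝ) : ℝ :=
  (∫ V : ZMod m → GaugeConfig 3 N G, (∏ t : ZMod m, wilsonSliceKernel ρ β (V t) (V (t + 1))) * F V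
      ∂(Measure.pi fun _ : ZMod m => Measure.pi fun _ : Edge 3 N => haarProbability G)) /
    cyclicPartition ρ β N m

/-- `mass_m(A) = P_{m × N³}(V₀ ∈ A)`: the one-slice probability of a set of spatial gauge fields. -/
def sliceMass (β : ℝ) (N m : ℕ) [NeZero N] [NeZero m] (A : Set (GaugeConfig 3 N G)) : ℝ :=
  cyclicExpectation ρ β N m fun V => A.indicator (fun _ => (1 : ℝ)) (V 0)

/-- `stay_m(A) = P_{m × N³}(V₀ ∈ A ∧ V₁ ∈ A)`: the probability that consecutive slices both lie in `A`;
`mass − stay` is the ESCAPE probability `P(V₀ ∈ A, V₁ ∉ A)`. -/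
def sliceStay (β : ℝ) (N m : ℕ) [NeZero N] [NeZero m] (A : Set (GaugeConfig 3 N G)) : ℝ :=
  cyclicExpectation ρ β N m fun V =>
    A.indicator (fun _ => (1 : ℝ)) (V 0) * A.indicator (fun _ => (1 : ℝ)) (V 1)

/-- `stay_m^{(n)}(A) = P_{m × N³}(V₀ ∈ A ∧ V_n ∈ A)`: both the time-zero slice and the slice at lag `n` lie in `A`
(`n` read in `ZMod m`; used only with `m` eventually large, so `n < m`).  `mass − stay^{(n)}` is the probability of
having LEFT `A` after `n` steps of Euclidean time; with `n = ⌈τ / a(β)⌉` this is escape within PHYSICAL time `τ`. -/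
def sliceStayN (β : ℝ) (N m : ℕ) [NeZero N] [NeZero m] (n : ℕ) (A : Set (GaugeConfig 3 N G)) : ℝ :=
  cyclicExpectation ρ β N m fun V =>
    A.indicator (fun _ => (1 : ℝ)) (V 0) * A.indicator (fun _ => (1 : ℝ)) (V (n : ZMod m))

end SliceChain

/-! ## §1 The statements (currency) -/

section Currency

variable (G : Type) [Group G] [TopologicalSpace G] [IsTopologicalGroup G] [CompactSpace G]
  [MeasurableSpace G] [BorelSpace G]

/-- **ONE-STEP CONDUCTANCE IN UNITS** (the lever, LOAD-BEARING currency; the DIFFUSIVE law, stronger than the gap face by a square and not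
implied back).  For `β ≥ β₂`, `S ≥ S₁ β` and EVERY measurable set `A` of time-zero slice
configurations of the spatial torus `(2S+1)³`, eventually in the temporal extent `m + 2`, the escape probability
dominates `c·√(a β)·mass·(1 − mass)` (Lawler–Sokal normalisation `Q(A,Aᶜ) ≥ k·π(A)π(Aᶜ)` in the `m → ∞` limit).
No gauge-invariance restriction on `A` is needed: the Gauss-law projection inside `wilsonSliceKernel` randomises gauge
orbits at every step, so non-invariant sets are left fast. -/
def SliceConductanceInUnits (r : LatticeRep G) (a : ℝ → ℝ) : Prop :=
  ∃ (c β₂ : ℝ) (S₁ : ℝ → ℕ), 0 < c ∧ ∀ β : ℝ, β₂ ≤ β → ∀ S : ℕ, S₁ β ≤ S →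
    ∀ A : Set (GaugeConfig 3 (2 * S + 1) G), MeasurableSet A →
      ∃ m₀ : ℕ, ∀ m : ℕ, m₀ ≤ m →
        haveI : NeZero (2 * S + 1) := ⟨by omega⟩
        c * Real.sqrt (a β) *
            (sliceMass r.ρ β (2 * S + 1) (m + 2) A * (1 - sliceMass r.ρ β (2 * S + 1) (m + 2) A))
          ≤ sliceMass r.ρ β (2 * S + 1) (m + 2) A - sliceStay r.ρ β (2 * S + 1) (m + 2) A

/-- **PHYSICAL-TIME CONDUCTANCE** (the EQUIVALENT shadow of the gap face — recorded, NOT a stub (critic-1: as a load it is the gap face in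
Cheeger clothing); the load is the one-step diffusive form `SliceConductanceInUnits` above).  For `β ≥ β₂`, `S ≥ S₁ β` and EVERY measurable set
`A` of time-zero slice configurations of the spatial torus `(2S+1)³`, eventually in the temporal extent, the probability of
having left `A` after `n(β) = ⌈τ / a β⌉` steps (physical Euclidean time `τ`) dominates `k₀ · mass · (1 − mass)` with ONE
constant `k₀ > 0`: no slice event is metastable on physical time scales, volume-uniformly, at every weak coupling.  By
Cheeger–Lawler–Sokal for the `n`-step kernel, `1 − r₁ⁿ ≥ k₀²/8`, i.e. `r₁ ≤ (1 − k₀²/8)^{1/n} ≤ exp(−k₀² a β/(16 τ))` once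
`a β ≤ τ` — exactly the rate of `GapInUnits`; conversely `k_n(A) ≥ 1 − r₁ⁿ ≥ 1 − e^{−c₁ τ}` for every `A`, so this currency
is EQUIVALENT to the gap face up to constants (census B6: EQUIV, priced; the content is in `stub_noStickySliceEvent`).
No gauge-invariance restriction on `A` is needed: `wilsonSliceKernel` integrates the temporal links, so it annihilates the
orthocomplement of gauge-invariant functions and non-invariant sets are left at once. -/
def PhysicalTimeConductance (r : LatticeRep G) (a : ℝ → ℝ) : Prop :=
  ∃ (k₀ τ β₂ : ℝ) (S₁ : ℝ → ℕ), 0 < k₀ ∧ 0 < τ ∧ ∀ β : ℝ, β₂ ≤ β → ∀ S : ℕ, S₁ β ≤ S →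
    ∀ A : Set (GaugeConfig 3 (2 * S + 1) G), MeasurableSet A →
      ∃ m₀ : ℕ, ∀ m : ℕ, m₀ ≤ m →
        haveI : NeZero (2 * S + 1) := ⟨by omega⟩
        k₀ * (sliceMass r.ρ β (2 * S + 1) (m + 2) A * (1 - sliceMass r.ρ β (2 * S + 1) (m + 2) A))
          ≤ sliceMass r.ρ β (2 * S + 1) (m + 2) A - sliceStayN r.ρ β (2 * S + 1) (m + 2) ⌈τ / a β⌉₊ A

/-- GAP FACE (verbatim the currency `SliceGapInUnits` of card `vacuum-maximal-correlation`, seat ym-cruxidea-19354-5):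
second transfer ratio `r₁ ≤ e^{-c₁ a(β)}` on the spatial torus `(2S+1)³`, `β ≥ β₂`, `S ≥ S₁ β`, through `traceExcess`
with a multiplicity constant `K(β,S)`. -/
def SliceGapInUnits (r : LatticeRep G) (a : ℝ → ℝ) : Prop :=
  ∃ (c₁ β₂ : ℝ) (S₁ : ℝ → ℕ), 0 < c₁ ∧ ∀ β : ℝ, β₂ ≤ β → ∀ S : ℕ, S₁ β ≤ S →
    ∃ K : ℝ, ∀ (t : ℕ) (_ht : 2 ≤ t),
      haveI : NeZero (2 * S + 1) := ⟨by omega⟩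
      haveI : NeZero t := ⟨by omega⟩
      traceExcess r.ρ β (2 * S + 1) t ≤ K * Real.exp (-(c₁ * a β * t))

/-- THERMAL FACE (verbatim the currency `ColdPurity` of the same card; same number as `DoublingDefect`'s cold defect):
the thermal multiplicity `x_{S+1}(β, 2S+1)` of the half-height cold torus is bounded, `S ≥ S₁ β`. -/
def ColdPurity (r : LatticeRep G) : Prop :=
  ∃ (K₀ β₂ : ℝ) (S₁ : ℝ → ℕ), ∀ β : ℝ, β₂ ≤ β → ∀ S : ℕ, S₁ β ≤ S →
    haveI : NeZero (2 * S + 1) := ⟨by omega⟩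
    haveI : NeZero (S + 1) := ⟨by omega⟩
    traceExcess r.ρ β (2 * S + 1) (S + 1) ≤ K₀

/-- **RUNG (census A1/B1 regime instance of the load; BC5-type witness, typed).**  STRONG-COUPLING one-step conductance: for
`0 ≤ β ≤ β₀` the slice chain leaves every measurable slice event with probability `≥ c·mass·(1 − mass)`, uniformly in the volume.  At `β = 0`
consecutive slices are independent and uniform (`wilsonSliceKernel ≡ 1`), so `stay = mass²` and `c = 1` exactly; for `0 < β ≤ β₀` it is the
Osterwalder–Seiler polymer-expansion regime [OsterwalderSeilerAnnPhys1978, Thm 3.5] via `k ≥ 1 − r₁` (variational direction). -/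
def SliceConductanceStrongCoupling (r : LatticeRep G) : Prop :=
  ∃ (c β₀ : ℝ), 0 < c ∧ 0 < β₀ ∧ ∀ β : ℝ, 0 ≤ β → β ≤ β₀ → ∀ S : ℕ,
    ∀ A : Set (GaugeConfig 3 (2 * S + 1) G), MeasurableSet A →
      ∃ m₀ : ℕ, ∀ m : ℕ, m₀ ≤ m →
        haveI : NeZero (2 * S + 1) := ⟨by omega⟩
        c * (sliceMass r.ρ β (2 * S + 1) (m + 2) A * (1 - sliceMass r.ρ β (2 * S + 1) (m + 2) A))
          ≤ sliceMass r.ρ β (2 * S + 1) (m + 2) A - sliceStay r.ρ β (2 * S + 1) (m + 2) A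

end Currency

/-- `IR` on the SIMPLY CONNECTED family (the complement of the registered residual `IRNSC`). -/
def IRSC : Prop :=
  ∀ (G : Type) [Group G] [TopologicalSpace G] [IsTopologicalGroup G] [CompactSpace G],
    IsCompactSimpleLieGroup G → SimplyConnectedSpace G →
    letI : MeasurableSpace G := borel G; haveI : BorelSpace G := ⟨rfl⟩;
    ∀ (r : LatticeRep G) (a : ℝ → ℝ), (∀ β, 0 < a β) → Tendsto a atTop (𝓝 0) →
      LowerBounds G r a → GapInUnits G r a

/-! ## §2 (The registered stubs live in the skeleton `Cruxes/IR/Lines/vacuum_escape.lean`, not here.)  Compositions (real proofs) -/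

/-- Simply connected family ∧ residual ⇒ the slot's calibrated form `IRCal` (cases on `SimplyConnectedSpace G`). -/
theorem irCal_of_SC_NSC (hS : IRSC) (hN : IRNSC) : IRCal := by
  intro G _ _ _ _ hG
  letI : MeasurableSpace G := borel G
  haveI : BorelSpace G := ⟨rfl⟩
  intro r a ha hat hlb
  by_cases hsc : SimplyConnectedSpace G
  · exact hS G hG hsc r a ha hat hlb
  · exact hN G hG hsc r a ha hat hlb

/-- **Composition in hypotheses form (kernel-checked, no `sorry`):** the five stub statements of the line (`stub_noStickySliceEvent`,
`stub_cheeger`, `stub_coldPurity`, `stub_spectralSeam`, `stub_irNSC`) imply crux `IR` BY NAME.  The skeleton's `IR_of` is this term applied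
to its registered stubs; nothing is discharged here. -/
theorem ir_of_vacuumEscape
    (h₁ : ∀ (G : Type) [Group G] [TopologicalSpace G] [IsTopologicalGroup G] [CompactSpace G],
      IsCompactSimpleLieGroup G → SimplyConnectedSpace G →
      letI : MeasurableSpace G := borel G; haveI : BorelSpace G := ⟨rfl⟩;
      ∀ (r : LatticeRep G) (a : ℝ → ℝ), (∀ β, 0 < a β) → Tendsto a atTop (𝓝 0) →
        LowerBounds G r a → SliceConductanceInUnits G r a)
    (h₂ : ∀ (G : Type) [Group G] [TopologicalSpace G] [IsTopologicalGroup G] [CompactSpace G]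
      [MeasurableSpace G] [BorelSpace G] (r : LatticeRep G) (a : ℝ → ℝ), (∀ β, 0 < a β) →
      SliceConductanceInUnits G r a → SliceGapInUnits G r a)
    (h₃ : ∀ (G : Type) [Group G] [TopologicalSpace G] [IsTopologicalGroup G] [CompactSpace G],
      IsCompactSimpleLieGroup G → SimplyConnectedSpace G →
      letI : MeasurableSpace G := borel G; haveI : BorelSpace G := ⟨rfl⟩;
      ∀ (r : LatticeRep G) (a : ℝ → ℝ), (∀ β, 0 < a β) → Tendsto a atTop (𝓝 0) →
        LowerBounds G r a → ColdPurity G r)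
    (h₄ : ∀ (G : Type) [Group G] [TopologicalSpace G] [IsTopologicalGroup G] [CompactSpace G]
      [MeasurableSpace G] [BorelSpace G], IsCompactSimpleLieGroup G →
      ∀ (r : LatticeRep G) (a : ℝ → ℝ), (∀ β, 0 < a β) → Tendsto a atTop (𝓝 0) →
        SliceGapInUnits G r a → ColdPurity G r → GapInUnits G r a)
    (h₅ : IRNSC) : Summit.QuantumFields.YangMills.Theses.BalabanLadder.IR := by
  have hS : IRSC := by
    intro G _ _ _ _ hG hsc
    letI : MeasurableSpace G := borel G
    haveI : BorelSpace G := ⟨rfl⟩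
    intro r a ha hat hlb
    exact h₄ G hG r a ha hat (h₂ G r a ha (h₁ G hG hsc r a ha hat hlb)) (h₃ G hG hsc r a ha hat hlb)
  have hI : IRCal := irCal_of_SC_NSC hS h₅
  delta Summit.QuantumFields.YangMills.Theses.BalabanLadder.IR
  delta Summit.QuantumFields.YangMills.Cruxes.IR.AfPincerUc.IRCal at hI
  exact hI

end Summit.QuantumFields.YangMills.Cruxes.IR.VacuumEscape

end
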